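import Literature.NumberTheory.LFunctions.MertensErrorTermsMeanValueRHProofs
import Literature.NumberTheory.LFunctions.AriasDeReynaKeiperLiPrimes
import Literature.NumberTheory.LFunctions.PrimeSumInvSqrt
import HarnessLib

/-!
# RH-EQUIVALENT literature, proof layer — «nothing here bears on the truth of RH»
# Zhao 2025, (2.4)–(2.5) PROVED: `E₂(x) = (π(x) − li(x))/x − ∫_x^∞ (π − li)/y²` and `∫₂^X E₂ = 2∫₂^∞ (π − li)/y² − X∫_X^∞ (π − li)/y²`

Proof companion of `MertensErrorTermsMeanValueRH.lean` (T. Zhao, Res. Number Theory 11 (2025) 62 =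
arXiv:2411.18903 [bib: `Zhao2025MertensMean`]); theorems only, no definition, no named fact; RH-free content.
§2 of the source treats `E₂(x) = Σ_{p≤x} 1/p − log log x − ℰ₂` through the formula (2.4)
«`Σ_{p≤x} 1/p = log log x + ℰ₂ + (π(x) − li(x))/x − ∫_x^∞ (π(y) − li(y))/y² dy` (which can be seen, e.g., by applying
[RS])», which «yields (2.5) `∫₂^X E₂(x) dx = −X ∫_X^∞ (π(x) − li(x))/x² dx + const`». This file PROVES both, with
`π(x) = Nat.primeCounting ⌊x⌋₊`, `li = logIntegral` (the tree's `li(x) = γ + log log x + Σ (log x)ⁿ/(n·n!)`), `ℰ₂ =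
Mertens.meisselMertens`:

* `Zhao2025.primeRecipSum_eq_primeCounting` — partial summation `Σ_{p≤x} 1/p = π(x)/x + ∫₂ˣ π(t)/t² dt` (Mathlib's
  `sum_mul_eq_sub_sub_integral_mul`);
* `Zhao2025.integral_logIntegral_div_sq` — `∫₂ˣ li(t)/t² dt = log log x − li(x)/x − log log 2 + li(2)/2` (the primitive
  `log log t − li(t)/t`);
* `Zhao2025.integrableOn_piLiKernel` — `(π − li)/t²` is integrable on `(2, ∞)` (the tree's prime number theorem for `π − li`,
  `AriasDeReyna2011Primes.exists_abs_primeCounting_sub_logIntegral_le`);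
* `Zhao2025.meisselMertens_eq_integral` — `ℰ₂ = ∫₂^∞ (π − li)/t² + li(2)/2 − log log 2` (letting `x → ∞` with
  `Mertens.tendsto_primeRecipSum_sub_loglog`);
* **`Zhao2025.E₂_eq_primeCounting_sub_li`** — (2.4); **`Zhao2025.integral_E₂_eq`** — (2.5), by the Fubini/tail computation of
  `MertensErrorTermsMeanValueRHProofs.lean` done for a general integrable kernel (`Zhao2025.integral_mul_sub_tail_eq`).
The explicit-formula and Landau steps for `i = 2` are not done here.
-/

noncomputable section

open Filter Topology Set MeasureTheory
open scoped Real Chebyshev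

namespace Literature.NumberTheory.LFunctions

namespace Zhao2025

/-! ### A general kernel: `∫₂^X (x g(x) − ∫_x^∞ g) dx = 2∫₂^∞ g − X ∫_X^∞ g` -/

/-- Fubini on the triangle `2 < x < t ≤ X` for an integrable kernel: `∫₂^X (∫_x^X g) dx = ∫₂^X (t − 2) g(t) dt`.
[cite: Zhao2025MertensMean, §2 (partial summation leading to (2.1) and (2.5))] -/
theorem integral_integral_kernel {g : ℝ → ℝ} (hg : Measurable g) {X : ℝ} (hX : 2 ≤ X)
    (hgi : IntegrableOn g (Ioc 2 X)) :
    ∫ x in (2 : ℝ)..X, (∫ t in x..X, g t) = ∫ t in (2 : ℝ)..X, (t - 2) * g t := by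
  set μ : Measure ℝ := volume.restrict (Ioc 2 X) with hμ
  haveI : IsFiniteMeasure μ := by
    rw [hμ]; exact ⟨by simp [Real.volume_Ioc]⟩
  have hgint : Integrable g μ := hgi
  set F : ℝ → ℝ → ℝ := fun x t => if x < t then g t else 0 with hF
  have hFmeas : Measurable (Function.uncurry F) := by
    have : Function.uncurry F = fun p : ℝ × ℝ => if p.1 < p.2 then g p.2 else 0 := by
      funext p; rfl
    rw [this]
    exact Measurable.ite (measurableSet_lt measurable_fst measurable_snd)
      (hg.comp measurable_snd) measurable_const
  have hFint : Integrable (Function.uncurry F) (μ.prod μ) := by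
    refine (hgint.comp_snd μ).norm.mono' hFmeas.aestronglyMeasurable (Eventually.of_forall fun p => ?_)
    simp only [Function.uncurry, hF]
    split_ifs
    · exact le_rfl
    · simp
  have hswap := integral_integral_swap hFint
  have hL : ∀ x ∈ Ioc (2 : ℝ) X, ∫ t, F x t ∂μ = ∫ t in x..X, g t := by
    intro x hx
    rw [intervalIntegral.integral_of_le hx.2, hμ]
    have : ∀ t, F x t = (Ioi x).indicator g t := by
      intro t; simp only [hF, indicator, mem_Ioi]
    simp_rw [this]
    rw [integral_indicator measurableSet_Ioi, Measure.restrict_restrict measurableSet_Ioi]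
    have hset : Ioi x ∩ Ioc 2 X = Ioc x X := by
      ext t
      simp only [mem_inter_iff, mem_Ioi, mem_Ioc]
      constructor
      · rintro ⟨h1, -, h3⟩; exact ⟨h1, h3⟩
      · rintro ⟨h1, h3⟩; exact ⟨h1, by linarith [hx.1], h3⟩
    rw [hset]
  have hR : ∀ t ∈ Ioc (2 : ℝ) X, ∫ x, F x t ∂μ = (t - 2) * g t := by
    intro t ht
    have : ∀ x, F x t = (Iio t).indicator (fun _ => g t) x := by
      intro x; simp only [hF, indicator, mem_Iio]
    simp_rw [this]
    rw [integral_indicator_const _ measurableSet_Iio, smul_eq_mul, hμ, measureReal_restrict_apply measurableSet_Iio]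
    have hset : Iio t ∩ Ioc 2 X = Ioo 2 t := by
      ext x; simp only [mem_inter_iff, mem_Iio, mem_Ioc, mem_Ioo]
      constructor
      · rintro ⟨h1, h2, -⟩; exact ⟨h2, h1⟩
      · rintro ⟨h1, h2⟩; exact ⟨h2, h1, h2.le.trans ht.2⟩
    rw [hset, Real.volume_real_Ioo_of_le ht.1.le]
  rw [intervalIntegral.integral_of_le hX, intervalIntegral.integral_of_le hX]
  have e1 : ∫ x in Ioc 2 X, (∫ t in x..X, g t) = ∫ x, (∫ t, F x t ∂μ) ∂μ := by
    rw [hμ]; exact (setIntegral_congr_fun measurableSet_Ioc hL).symm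
  have e2 : ∫ t in Ioc 2 X, (t - 2) * g t = ∫ t, (∫ x, F x t ∂μ) ∂μ := by
    rw [hμ]; exact (setIntegral_congr_fun measurableSet_Ioc hR).symm
  rw [e1, e2, hswap]

/-- **The mean of `x g(x) − ∫_x^∞ g`**: for a kernel `g` integrable on `(2, ∞)` with `x g(x)` integrable on `[2, X]`,
`∫₂^X (x g(x) − ∫_x^∞ g(t) dt) dx = 2∫₂^∞ g − X ∫_X^∞ g` — the computation behind (2.1) (`g = (θ − t)/t²`) and
(2.5) (`g = (π − li)/t²`). [cite: Zhao2025MertensMean, §2 (2.1) and (2.5)] -/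
theorem integral_mul_sub_tail_eq {g : ℝ → ℝ} (hg : Measurable g) (hgi : IntegrableOn g (Ioi 2)) {X : ℝ}
    (hX : 2 ≤ X) (hxg : IntervalIntegrable (fun x : ℝ => x * g x) volume 2 X) :
    ∫ x in (2 : ℝ)..X, (x * g x - ∫ t in Ioi x, g t) =
      2 * (∫ t in Ioi (2 : ℝ), g t) - X * ∫ t in Ioi X, g t := by
  set TX : ℝ := ∫ t in Ioi X, g t with hTX
  set C : ℝ := ∫ t in Ioi (2 : ℝ), g t with hC
  have htail : ∀ x : ℝ, 2 ≤ x → x ≤ X → ∫ t in Ioi x, g t = (∫ t in x..X, g t) + TX := by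
    intro x hx hxX
    rw [← Ioc_union_Ioi_eq_Ioi hxX, setIntegral_union (Ioc_disjoint_Ioi le_rfl) measurableSet_Ioi
      (hgi.mono_set (Ioc_subset_Ioi_self.trans (Ioi_subset_Ioi hx))) (hgi.mono_set (Ioi_subset_Ioi (hx.trans hxX))),
      intervalIntegral.integral_of_le hxX]
  have hE : EqOn (fun x : ℝ => x * g x - ∫ t in Ioi x, g t) (fun x => x * g x - (∫ t in x..X, g t) - TX) (uIcc 2 X) := by
    intro x hx
    rw [uIcc_of_le hX] at hx
    simp only
    rw [htail x hx.1 hx.2]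
    ring
  have hgIcc : IntegrableOn g (Icc 2 X) := by
    rw [integrableOn_Icc_iff_integrableOn_Ioc]; exact hgi.mono_set Ioc_subset_Ioi_self
  have h2 : IntervalIntegrable (fun x : ℝ => ∫ t in x..X, g t) volume 2 X := by
    refine ContinuousOn.intervalIntegrable ?_
    exact intervalIntegral.continuousOn_primitive_interval_left (μ := volume) (f := g) (a := 2) (b := X)
      (by rw [uIcc_of_le hX]; exact hgIcc)
  have h3 : IntervalIntegrable (fun _ : ℝ => TX) volume 2 X := intervalIntegrable_const
  have hgI : IntervalIntegrable g volume 2 X := by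
    rw [intervalIntegrable_iff_integrableOn_Ioc_of_le hX]; exact hgi.mono_set Ioc_subset_Ioi_self
  rw [intervalIntegral.integral_congr hE, intervalIntegral.integral_sub (hxg.sub h2) h3,
    intervalIntegral.integral_sub hxg h2, intervalIntegral.integral_const, smul_eq_mul,
    integral_integral_kernel hg hX (hgi.mono_set Ioc_subset_Ioi_self)]
  have h4 : ∫ t in (2 : ℝ)..X, (t - 2) * g t = (∫ t in (2 : ℝ)..X, t * g t) - 2 * ∫ t in (2 : ℝ)..X, g t := by
    have hcongr : EqOn (fun t : ℝ => (t - 2) * g t) (fun t => t * g t - 2 * g t) (uIcc 2 X) := by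
      intro t _; simp only; ring
    rw [intervalIntegral.integral_congr hcongr, intervalIntegral.integral_sub hxg (hgI.const_mul 2),
      intervalIntegral.integral_const_mul]
  have h5 : ∫ t in (2 : ℝ)..X, g t = C - TX := by
    have := htail 2 le_rfl hX
    rw [hC, hTX]; linarith
  rw [h4, h5]
  ring

/-! ### Partial summation for `Σ_{p≤x} 1/p` and the `li` integral -/

/-- `x ↦ π(x)` is measurable. [cite: Zhao2025MertensMean, §1.4 (notation π(x))] -/
theorem measurable_primeCounting_real : Measurable fun t : ℝ => (Nat.primeCounting ⌊t⌋₊ : ℝ) := by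
  have : (fun t : ℝ => (Nat.primeCounting ⌊t⌋₊ : ℝ)) = (fun n : ℕ => (Nat.primeCounting n : ℝ)) ∘ Nat.floor := by
    funext t; rfl
  rw [this]
  exact (measurable_from_nat (f := fun n : ℕ => (Nat.primeCounting n : ℝ))).comp Nat.measurable_floor

/-- `0 ≤ π(t) ≤ t` for `t ≥ 0`. [cite: Zhao2025MertensMean, §1.4 (notation π(x))] -/
theorem primeCounting_real_le {t : ℝ} (ht : 0 ≤ t) : (Nat.primeCounting ⌊t⌋₊ : ℝ) ≤ t := by
  have h1 : (Nat.primeCounting ⌊t⌋₊ : ℝ) ≤ ⌊t⌋₊ := by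
    exact_mod_cast (Nat.primesLE_card_eq_primeCounting ⌊t⌋₊).symm.le.trans
      ((Finset.card_le_card (fun k hk => by
        rw [Nat.primesLE_eq_filter_Ioc_zero, Finset.mem_filter] at hk; exact hk.1)).trans (by simp))
  exact h1.trans (Nat.floor_le ht)

/-- **Partial summation**: `Σ_{p≤x} 1/p = π(x)/x + ∫₂ˣ π(t)/t² dt` for `x ≥ 2`.
[cite: Zhao2025MertensMean, §2 (2.4) ("by applying [RS]")] -/
theorem primeRecipSum_eq_primeCounting {x : ℝ} (hx : 2 ≤ x) :
    Mertens.primeRecipSum x = (Nat.primeCounting ⌊x⌋₊ : ℝ) / x +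
      ∫ t in Ioc 2 x, (Nat.primeCounting ⌊t⌋₊ : ℝ) / t ^ 2 := by
  set c : ℕ → ℝ := fun k => if k.Prime then 1 else 0 with hc
  set f : ℝ → ℝ := fun t => t⁻¹ with hf
  have hderiv : ∀ t : ℝ, 1 < t → HasDerivAt f (-(t ^ 2)⁻¹) t := fun t ht => by
    simpa using hasDerivAt_inv (show t ≠ 0 by linarith)
  have hf_diff : ∀ t ∈ Set.Icc 2 x, DifferentiableAt ℝ f t := fun t ht =>
    (hderiv t (by linarith [ht.1])).differentiableAt
  have hderiv_eq : Set.EqOn (fun t : ℝ => -(t ^ 2)⁻¹) (deriv f) (Set.Icc 2 x) := fun t ht =>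
    ((hderiv t (by linarith [ht.1])).deriv).symm
  have hmem : ∀ t ∈ Set.Icc 2 x, t ∈ ({0}ᶜ : Set ℝ) := fun t ht =>
    Set.mem_compl_singleton_iff.mpr (show (0 : ℝ) < t by linarith [ht.1]).ne'
  have hgcont : ContinuousOn (fun t : ℝ => -(t ^ 2)⁻¹) (Set.Icc 2 x) := by
    refine ContinuousOn.neg (ContinuousOn.inv₀ (continuous_pow 2).continuousOn ?_)
    intro t ht
    exact pow_ne_zero _ (show t ≠ 0 by linarith [ht.1])
  have hf_int : IntegrableOn (deriv f) (Set.Icc 2 x) :=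
    hgcont.integrableOn_Icc.congr_fun hderiv_eq measurableSet_Icc
  have habel := sum_mul_eq_sub_sub_integral_mul c (by norm_num : (0 : ℝ) ≤ 2) hx hf_diff hf_int
  have hS : ∀ t : ℝ, ∑ k ∈ Finset.Icc 0 ⌊t⌋₊, c k = (Nat.primeCounting ⌊t⌋₊ : ℝ) := fun t =>
    ChebyshevInvSqrt.sum_indicator_prime_eq _
  have hfl2 : ⌊(2 : ℝ)⌋₊ = 2 := by norm_num
  have hfc : ∀ k : ℕ, f k * c k = if k.Prime then (k : ℝ)⁻¹ else 0 := by
    intro k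
    simp only [hf, hc]
    split_ifs <;> simp
  have hsum : ∀ n : ℕ, ∑ k ∈ Finset.Ioc 0 n, f k * c k = ∑ p ∈ Nat.primesLE n, (p : ℝ)⁻¹ := by
    intro n
    rw [Nat.primesLE_eq_filter_Ioc_zero, Finset.sum_filter]
    exact Finset.sum_congr rfl fun k _ => hfc k
  have hx2 : 2 ≤ ⌊x⌋₊ := Nat.le_floor (by simpa using hx)
  have hlhs : ∑ k ∈ Finset.Ioc ⌊(2 : ℝ)⌋₊ ⌊x⌋₊, f k * c k = Mertens.primeRecipSum x - 2⁻¹ := by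
    rw [hfl2, Mertens.primeRecipSum, ← hsum, eq_sub_iff_add_eq, add_comm,
      Finset.sum_Ioc_consecutive _ (Nat.zero_le 2) hx2 |>.symm]
    congr 1
    rw [show Finset.Ioc 0 2 = {1, 2} by decide, Finset.sum_pair (by norm_num), hfc, hfc]
    norm_num [Nat.prime_two, Nat.not_prime_one]
  have hπ2 : (Nat.primeCounting 2 : ℝ) = 1 := by
    have : Nat.primeCounting 2 = 1 := by decide
    exact_mod_cast this
  have hb2 : f 2 * ∑ k ∈ Finset.Icc 0 ⌊(2 : ℝ)⌋₊, c k = 2⁻¹ := by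
    rw [hS, hfl2, hf]
    push_cast
    rw [hπ2, mul_one]
  have hbx : f x * ∑ k ∈ Finset.Icc 0 ⌊x⌋₊, c k = (Nat.primeCounting ⌊x⌋₊ : ℝ) / x := by
    rw [hS, hf, inv_mul_eq_div]
  have hint : ∫ t in Set.Ioc 2 x, deriv f t * ∑ k ∈ Finset.Icc 0 ⌊t⌋₊, c k =
      -∫ t in Ioc 2 x, (Nat.primeCounting ⌊t⌋₊ : ℝ) / t ^ 2 := by
    rw [← integral_neg]
    refine setIntegral_congr_fun measurableSet_Ioc fun t ht => ?_
    rw [← hderiv_eq (Set.Ioc_subset_Icc_self ht), hS]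
    ring
  rw [hlhs, hb2, hbx, hint] at habel
  linarith

/-- **`∫₂ˣ li(t)/t² dt = log log x − li(x)/x − (log log 2 − li(2)/2)`** (`x ≥ 2`): the primitive of `li(t)/t²` on
`(1, ∞)` is `log log t − li(t)/t` (`li' = 1/log`). [cite: Zhao2025MertensMean, §2 (2.4) ("by applying [RS]")] -/
theorem integral_logIntegral_div_sq {x : ℝ} (hx : 2 ≤ x) :
    ∫ t in Ioc 2 x, logIntegral t / t ^ 2 =
      Real.log (Real.log x) - logIntegral x / x - (Real.log (Real.log 2) - logIntegral 2 / 2) := by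
  have hderiv : ∀ t ∈ uIcc (2 : ℝ) x,
      HasDerivAt (fun t : ℝ => Real.log (Real.log t) - logIntegral t / t) (logIntegral t / t ^ 2) t := by
    intro t ht
    rw [uIcc_of_le hx] at ht
    have ht1 : 1 < t := by linarith [ht.1]
    have ht0 : t ≠ 0 := by linarith [ht.1]
    have hlog : Real.log t ≠ 0 := (Real.log_pos ht1).ne'
    have h1 : HasDerivAt (fun t : ℝ => Real.log (Real.log t)) ((Real.log t)⁻¹ * t⁻¹) t :=
      (Real.hasDerivAt_log hlog).comp t (Real.hasDerivAt_log ht0)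
    have h2 : HasDerivAt (fun t : ℝ => logIntegral t / t)
        (((Real.log t)⁻¹ * t - logIntegral t * 1) / t ^ 2) t :=
      (hasDerivAt_logIntegral_holds ht1).div (hasDerivAt_id t) ht0
    have heq : (Real.log t)⁻¹ * t⁻¹ - ((Real.log t)⁻¹ * t - logIntegral t * 1) / t ^ 2 =
        logIntegral t / t ^ 2 := by
      rw [mul_one, inv_mul_eq_div, sub_div, div_eq_mul_inv ((Real.log t)⁻¹ * t) (t ^ 2)]
      have : (Real.log t)⁻¹ * t * (t ^ 2)⁻¹ = (Real.log t)⁻¹ / t := by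
        field_simp
      rw [this]
      ring
    exact (h1.sub h2).congr_deriv heq
  have hcont : ContinuousOn (fun t : ℝ => logIntegral t / t ^ 2) (uIcc 2 x) := by
    rw [uIcc_of_le hx]
    refine (VonKochTransfer.continuousOn_logIntegral.mono fun t ht => ?_).div (continuousOn_pow 2) fun t ht =>
      pow_ne_zero _ (by linarith [ht.1])
    exact show (1 : ℝ) < t by linarith [ht.1]
  have hint : IntervalIntegrable (fun t : ℝ => logIntegral t / t ^ 2) volume 2 x :=
    hcont.intervalIntegrable
  rw [← intervalIntegral.integral_of_le hx, intervalIntegral.integral_eq_sub_of_hasDerivAt hderiv hint]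

/-! ### The kernel `(π − li)/t²` -/

/-- `(π(t) − li(t))/t²` is integrable on `(2, ∞)` (`π − li ≪ t/log² t`, the prime number theorem).
[cite: Zhao2025MertensMean, §2 (2.4)] -/
theorem integrableOn_piLiKernel :
    IntegrableOn (fun t : ℝ => ((Nat.primeCounting ⌊t⌋₊ : ℝ) - logIntegral t) / t ^ 2) (Ioi 2) := by
  obtain ⟨X, C, hX2, hC0, hC⟩ := AriasDeReyna2011Primes.exists_abs_primeCounting_sub_logIntegral_le 2
  have hmeas : AEStronglyMeasurable (fun t : ℝ => ((Nat.primeCounting ⌊t⌋₊ : ℝ) - logIntegral t) / t ^ 2)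
      (volume.restrict (Ioi 2)) :=
    ((measurable_primeCounting_real.sub measurable_logIntegral).div (measurable_id.pow_const 2)).aestronglyMeasurable
  rw [← Ioc_union_Ioi_eq_Ioi hX2]
  refine IntegrableOn.union ?_ ?_
  · -- on `(2, X]`: `π(t)/t²` is bounded, `li(t)/t²` is continuous
    have hπ : IntegrableOn (fun t : ℝ => (Nat.primeCounting ⌊t⌋₊ : ℝ) / t ^ 2) (Ioc 2 X) := by
      refine Measure.integrableOn_of_bounded (M := 1) measure_Ioc_lt_top.ne
        ((measurable_primeCounting_real.div (measurable_id.pow_const 2)).aestronglyMeasurable) ?_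
      rw [ae_restrict_iff' measurableSet_Ioc]
      refine Eventually.of_forall fun t ht => ?_
      have ht0 : 0 < t := by linarith [ht.1]
      rw [Real.norm_eq_abs, abs_div, abs_of_nonneg (Nat.cast_nonneg _), abs_of_pos (by positivity),
        div_le_one (by positivity)]
      calc (Nat.primeCounting ⌊t⌋₊ : ℝ) ≤ t := primeCounting_real_le ht0.le
        _ ≤ t ^ 2 := by nlinarith [ht.1]
    have hli : IntegrableOn (fun t : ℝ => logIntegral t / t ^ 2) (Ioc 2 X) := by
      have hc : ContinuousOn (fun t : ℝ => logIntegral t / t ^ 2) (Icc 2 X) := by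
        refine (VonKochTransfer.continuousOn_logIntegral.mono fun t ht => ?_).div (continuousOn_pow 2) fun t ht =>
          pow_ne_zero _ (by linarith [ht.1])
        exact show (1 : ℝ) < t by linarith [ht.1]
      exact hc.integrableOn_Icc.mono_set Ioc_subset_Icc_self
    refine (hπ.sub hli).congr_fun (fun t _ => ?_) measurableSet_Ioc
    simp only [Pi.sub_apply]
    ring
  · -- on `(X, ∞)`: `|π − li|/t² ≤ C/(t log² t)`
    have hX1 : 1 < X := by linarith
    have hmaj : IntegrableOn (fun t : ℝ => C * (t⁻¹ / Real.log t ^ 2)) (Ioi X) :=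
      (Mertens.integrableOn_inv_div_log_sq.mono_set (Ioi_subset_Ioi hX2)).const_mul C
    refine Integrable.mono' hmaj (hmeas.mono_measure (Measure.restrict_mono (Ioi_subset_Ioi hX2) le_rfl)) ?_
    rw [ae_restrict_iff' measurableSet_Ioi]
    refine Eventually.of_forall fun t ht => ?_
    have htX : X < t := ht
    have ht0 : 0 < t := by linarith
    have h := hC t htX.le
    rw [Real.norm_eq_abs, abs_div, abs_of_pos (by positivity : (0 : ℝ) < t ^ 2), div_le_iff₀ (by positivity)]
    calc |(Nat.primeCounting ⌊t⌋₊ : ℝ) - logIntegral t| ≤ C * (t / Real.log t ^ 2) := h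
      _ = C * (t⁻¹ / Real.log t ^ 2) * t ^ 2 := by field_simp

/-- `t · (π − li)(t)/t² = (π − li)(t)/t` is integrable on `[2, X]`. [cite: Zhao2025MertensMean, §2 (2.5)] -/
theorem intervalIntegrable_mul_piLiKernel {X : ℝ} (hX : 2 ≤ X) :
    IntervalIntegrable (fun x : ℝ => x * (((Nat.primeCounting ⌊x⌋₊ : ℝ) - logIntegral x) / x ^ 2)) volume 2 X := by
  rw [intervalIntegrable_iff_integrableOn_Ioc_of_le hX]
  have hπ : IntegrableOn (fun t : ℝ => (Nat.primeCounting ⌊t⌋₊ : ℝ) / t) (Ioc 2 X) := by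
    refine Measure.integrableOn_of_bounded (M := 1) measure_Ioc_lt_top.ne
      ((measurable_primeCounting_real.div measurable_id).aestronglyMeasurable) ?_
    rw [ae_restrict_iff' measurableSet_Ioc]
    refine Eventually.of_forall fun t ht => ?_
    have ht0 : 0 < t := by linarith [ht.1]
    rw [Real.norm_eq_abs, abs_div, abs_of_nonneg (Nat.cast_nonneg _), abs_of_pos ht0, div_le_one ht0]
    exact primeCounting_real_le ht0.le
  have hli : IntegrableOn (fun t : ℝ => logIntegral t / t) (Ioc 2 X) := by
    have hc : ContinuousOn (fun t : ℝ => logIntegral t / t) (Icc 2 X) := by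
      refine (VonKochTransfer.continuousOn_logIntegral.mono fun t ht => ?_).div continuousOn_id fun t ht =>
        (show (0 : ℝ) < t by linarith [ht.1]).ne'
      exact show (1 : ℝ) < t by linarith [ht.1]
    exact hc.integrableOn_Icc.mono_set Ioc_subset_Icc_self
  refine (hπ.sub hli).congr_fun (fun t ht => ?_) measurableSet_Ioc
  have ht0 : t ≠ 0 := by linarith [ht.1]
  simp only [Pi.sub_apply]
  field_simp

/-! ### (2.4) and (2.5) -/

/-- `Σ_{p≤x} 1/p − log log x = (π − li)(x)/x + ∫₂ˣ (π − li)/t² + (li(2)/2 − log log 2)` for `x ≥ 2`.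
[cite: Zhao2025MertensMean, §2 (2.4)] -/
theorem primeRecipSum_sub_loglog_eq {x : ℝ} (hx : 2 ≤ x) :
    Mertens.primeRecipSum x - Real.log (Real.log x) =
      ((Nat.primeCounting ⌊x⌋₊ : ℝ) - logIntegral x) / x +
        (∫ t in Ioc 2 x, ((Nat.primeCounting ⌊t⌋₊ : ℝ) - logIntegral t) / t ^ 2) +
          (logIntegral 2 / 2 - Real.log (Real.log 2)) := by
  have hπ : IntegrableOn (fun t : ℝ => (Nat.primeCounting ⌊t⌋₊ : ℝ) / t ^ 2) (Ioc 2 x) := by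
    refine Measure.integrableOn_of_bounded (M := 1) measure_Ioc_lt_top.ne
      ((measurable_primeCounting_real.div (measurable_id.pow_const 2)).aestronglyMeasurable) ?_
    rw [ae_restrict_iff' measurableSet_Ioc]
    refine Eventually.of_forall fun t ht => ?_
    have ht0 : 0 < t := by linarith [ht.1]
    rw [Real.norm_eq_abs, abs_div, abs_of_nonneg (Nat.cast_nonneg _), abs_of_pos (by positivity),
      div_le_one (by positivity)]
    calc (Nat.primeCounting ⌊t⌋₊ : ℝ) ≤ t := primeCounting_real_le ht0.le
      _ ≤ t ^ 2 := by nlinarith [ht.1]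
  have hli : IntegrableOn (fun t : ℝ => logIntegral t / t ^ 2) (Ioc 2 x) := by
    have hc : ContinuousOn (fun t : ℝ => logIntegral t / t ^ 2) (Icc 2 x) := by
      refine (VonKochTransfer.continuousOn_logIntegral.mono fun t ht => ?_).div (continuousOn_pow 2) fun t ht =>
        pow_ne_zero _ (by linarith [ht.1])
      exact show (1 : ℝ) < t by linarith [ht.1]
    exact hc.integrableOn_Icc.mono_set Ioc_subset_Icc_self
  have hsplit : ∫ t in Ioc 2 x, ((Nat.primeCounting ⌊t⌋₊ : ℝ) - logIntegral t) / t ^ 2 =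
      (∫ t in Ioc 2 x, (Nat.primeCounting ⌊t⌋₊ : ℝ) / t ^ 2) - ∫ t in Ioc 2 x, logIntegral t / t ^ 2 := by
    rw [← integral_sub hπ hli]
    refine setIntegral_congr_fun measurableSet_Ioc fun t _ => ?_
    ring
  rw [hsplit, primeRecipSum_eq_primeCounting hx, integral_logIntegral_div_sq hx]
  ring

/-- **`ℰ₂ = ∫₂^∞ (π − li)/t² + li(2)/2 − log log 2`**: the constant of (2.4) is Mertens' `ℰ₂` (`Mertens.meisselMertens`), by
letting `x → ∞` (`(π − li)(x)/x → 0` by the prime number theorem, `Σ_{p≤x} 1/p − log log x → ℰ₂`).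
[cite: Zhao2025MertensMean, §2 (2.4)] -/
theorem meisselMertens_eq_integral :
    Mertens.meisselMertens = (∫ t in Ioi (2 : ℝ), ((Nat.primeCounting ⌊t⌋₊ : ℝ) - logIntegral t) / t ^ 2) +
      (logIntegral 2 / 2 - Real.log (Real.log 2)) := by
  set k : ℝ → ℝ := fun t => ((Nat.primeCounting ⌊t⌋₊ : ℝ) - logIntegral t) / t ^ 2 with hk
  -- `(π − li)(x)/x → 0`
  have h1 : Tendsto (fun x : ℝ => ((Nat.primeCounting ⌊x⌋₊ : ℝ) - logIntegral x) / x) atTop (𝓝 0) := by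
    obtain ⟨X, C, hX2, hC0, hC⟩ := AriasDeReyna2011Primes.exists_abs_primeCounting_sub_logIntegral_le 2
    have hmaj : Tendsto (fun x : ℝ => C / Real.log x ^ 2) atTop (𝓝 0) :=
      tendsto_const_nhds.div_atTop ((tendsto_pow_atTop two_ne_zero).comp Real.tendsto_log_atTop)
    refine squeeze_zero_norm' ?_ hmaj
    filter_upwards [eventually_ge_atTop X] with x hx
    have hx0 : 0 < x := by linarith
    have hlog : 0 < Real.log x := Real.log_pos (by linarith)
    rw [Real.norm_eq_abs, abs_div, abs_of_pos hx0, div_le_iff₀ hx0]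
    calc |(Nat.primeCounting ⌊x⌋₊ : ℝ) - logIntegral x| ≤ C * (x / Real.log x ^ 2) := hC x hx
      _ = C / Real.log x ^ 2 * x := by field_simp
  -- `∫₂ˣ k → ∫₂^∞ k`
  have h2 : Tendsto (fun x : ℝ => ∫ t in Ioc 2 x, k t) atTop (𝓝 (∫ t in Ioi (2 : ℝ), k t)) := by
    have h := intervalIntegral_tendsto_integral_Ioi (a := 2) (f := k) (μ := volume) (l := atTop) (b := id)
      integrableOn_piLiKernel tendsto_id
    refine h.congr' ?_
    filter_upwards [eventually_ge_atTop (2 : ℝ)] with x hx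
    simp only [id]
    rw [intervalIntegral.integral_of_le hx]
  have h3 : Tendsto (fun x : ℝ => Mertens.primeRecipSum x - Real.log (Real.log x)) atTop
      (𝓝 (0 + (∫ t in Ioi (2 : ℝ), k t) + (logIntegral 2 / 2 - Real.log (Real.log 2)))) := by
    refine ((h1.add h2).add tendsto_const_nhds).congr' ?_
    filter_upwards [eventually_ge_atTop (2 : ℝ)] with x hx
    rw [primeRecipSum_sub_loglog_eq hx]
  have := tendsto_nhds_unique Mertens.tendsto_primeRecipSum_sub_loglog h3
  rw [this, zero_add]

/-- **Zhao 2025, (2.4), PROVED**: for `x ≥ 2`,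
`E₂(x) = (π(x) − li(x))/x − ∫_x^∞ (π(t) − li(t)) t⁻² dt` (`π(x) = Nat.primeCounting ⌊x⌋₊`, `li = logIntegral`).
[cite: Zhao2025MertensMean, §2 (2.4)] -/
theorem E₂_eq_primeCounting_sub_li {x : ℝ} (hx : 2 ≤ x) :
    E₂ x = ((Nat.primeCounting ⌊x⌋₊ : ℝ) - logIntegral x) / x -
      ∫ t in Ioi x, ((Nat.primeCounting ⌊t⌋₊ : ℝ) - logIntegral t) / t ^ 2 := by
  have htail : ∫ t in Ioi (2 : ℝ), ((Nat.primeCounting ⌊t⌋₊ : ℝ) - logIntegral t) / t ^ 2 =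
      (∫ t in Ioc 2 x, ((Nat.primeCounting ⌊t⌋₊ : ℝ) - logIntegral t) / t ^ 2) +
        ∫ t in Ioi x, ((Nat.primeCounting ⌊t⌋₊ : ℝ) - logIntegral t) / t ^ 2 := by
    rw [← Ioc_union_Ioi_eq_Ioi hx, setIntegral_union (Ioc_disjoint_Ioi le_rfl) measurableSet_Ioi
      (integrableOn_piLiKernel.mono_set Ioc_subset_Ioi_self) (integrableOn_piLiKernel.mono_set (Ioi_subset_Ioi hx))]
  unfold E₂
  rw [primeRecipSum_sub_loglog_eq hx, meisselMertens_eq_integral, htail]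
  ring

/-- **Zhao 2025, (2.5), PROVED**: for `X ≥ 2`,
`∫₂^X E₂(x) dx = 2∫₂^∞ (π − li)/t² − X ∫_X^∞ (π − li)/t²` (the source writes `−X∫_X^∞ (π − li)/x² + const`).
[cite: Zhao2025MertensMean, §2 (2.5)] -/
theorem integral_E₂_eq {X : ℝ} (hX : 2 ≤ X) :
    ∫ x in (2 : ℝ)..X, E₂ x =
      2 * (∫ t in Ioi (2 : ℝ), ((Nat.primeCounting ⌊t⌋₊ : ℝ) - logIntegral t) / t ^ 2) -
        X * ∫ t in Ioi X, ((Nat.primeCounting ⌊t⌋₊ : ℝ) - logIntegral t) / t ^ 2 := by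
  have hE : EqOn E₂ (fun x : ℝ => x * (((Nat.primeCounting ⌊x⌋₊ : ℝ) - logIntegral x) / x ^ 2) -
      ∫ t in Ioi x, ((Nat.primeCounting ⌊t⌋₊ : ℝ) - logIntegral t) / t ^ 2) (uIcc 2 X) := by
    intro x hx
    rw [uIcc_of_le hX] at hx
    have hx0 : x ≠ 0 := by linarith [hx.1]
    simp only
    rw [E₂_eq_primeCounting_sub_li hx.1]
    field_simp
  rw [intervalIntegral.integral_congr hE]
  exact integral_mul_sub_tail_eq ((measurable_primeCounting_real.sub measurable_logIntegral).div
    (measurable_id.pow_const 2)) integrableOn_piLiKernel hX (intervalIntegrable_mul_piLiKernel hX)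

end Zhao2025

end Literature.NumberTheory.LFunctions
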